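import Literature.AlgebraicGeometry.ShimuraVarieties.UnitaryBallAutomorphicFubiniStudyForm
import Literature.Geometry.Kaehler.LocalForms
import HarnessLib

/-!
# Two projective systems of one weight have cohomologous Fubini–Study forms; twisted systems

Layer `Literature/AlgebraicGeometry/ShimuraVarieties`, grouping namespace `BallFS`; sequel of
`UnitaryBallAutomorphicFubiniStudyForm` (`[G]^*ω_FS` on `Δ\𝔹²` for a projective system `G` of automorphic forms
of weight `k`). PROVED here (three definitions with bodies + theorems; no named facts):

* `BallFS.fsPotentialMForm` — the Fubini–Study potential `α₀(Z) = Im ⟪Z, ·⟫/‖Z‖²` as a `1`-form on `ℂᴺ⁺¹`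
  (`dα₀ = β₀`, `mextDeriv_fsPotentialMForm_apply`), its pull-backs `G^*α₀` and their **projective variance**
  `(fG)^*α₀ = G^*α₀ + Im(df/f)` (`fubiniStudyPotential_smul_add_smul`), whence
  `(fG₁)^*α₀ − (fG₂)^*α₀ = G₁^*α₀ − G₂^*α₀` (`fsPotentialMForm_pullback_smul_sub`);
* `BallFS.fsPotDiff G₁ G₂` — for two systems of the SAME weight, the smooth real `1`-form on `Δ\𝔹²` which is
  locally `(G₁ ∘ s_p)^*α₀ − (G₂ ∘ s_p)^*α₀` for ANY local section `s_p` (two sections differ by a locally constant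
  `δ ∈ Δ` and both systems pick up the same factor `j(δ, ·)⁻ᵏ`, `fsPotDiff_eq_of_mem_source`), with
  **`BallFS.fsForm_sub_fsForm_eq_mextDeriv`**: `[G₁]^*ω_FS − [G₂]^*ω_FS = d(fsPotDiff G₁ G₂)` and
  **`BallFS.deRhamCohomology_mk_fsForm_eq`**: `[[G₁]^*ω_FS] = [[G₂]^*ω_FS]` in `H²_dR(Δ\𝔹²; ℝ)` (Griffiths–Harris
  Ch. 1 §2: the class of the pulled-back Fubini–Study form depends only on the line bundle `[G]^*𝒪(1) = K^{⊗k}`);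
* `BallFS.twist g G k = S_g G`, `S_g G(z) = j(g, z)ᵏ • G(g z)` — for `g ∈ U(2,1)` with `g Δ₁ g⁻¹ ≤ Δ₂` the twist of
  a `Δ₂`-system of weight `k` is a `Δ₁`-system of weight `k` (`twist_mem_factorForms`, cocycle identity), and a map
  `φ : Δ₁\𝔹² → Δ₂\𝔹²` lifting to `z ↦ g z` has `[G] ∘ φ = [S_g G]` (`projMap_comp_eq_projMap_twist`),
  `φ^*([G]^*ω_FS) = [S_g G]^*ω_FS` (`fsForm_pullback_eq_fsForm_twist`, `deRhamCohomology_map_mk_fsForm`)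
  (Shimura 1971 §3.1, §7.2: the two legs of a Hecke correspondence of ball quotients).

## References

* I. R. Shafarevich, *Basic Algebraic Geometry 2* (Springer 1994), Ch. VIII §1.2, Ch. IX §3.1–3.3. [Shafarevich1994]
* P. Griffiths, J. Harris, *Principles of Algebraic Geometry* (1978), Ch. 0 §2, Ch. 1 §2. [GriffithsHarrisPrinciples1978]
* C. Voisin, *Hodge Theory and Complex Algebraic Geometry I* (2002), §3.1.1 Lemma 3.3, §3.1.3, §3.3.2 Lemma 3.16, §7.1.2. [VoisinHodgeI2002]
* G. Shimura, *Introduction to the Arithmetic Theory of Automorphic Functions* (1971), §3.1 Prop. 3.1, §7.2–7.3. [Shimura1971]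

## Provenance

pub-hodgecm2 cell (COR-CM, Hodge ladder stage 2), lane KAEHLER-HECKE-INV (b10): the invariant rational Kähler
class (ℓ) of the Hecke-correspondence line R-A of the S2 crux. Everything here is kernel-checked; no named facts.
-/

set_option autoImplicit false

noncomputable section

open scoped Manifold ContDiff Topology InnerProductSpace ComplexConjugate
open Set Function MulAction Filter Complex
open Literature.Geometry.ComplexHyperbolic
open Literature.Geometry.ComplexHyperbolic.BallModel (U21 Ball)
open Literature.Geometry.Manifold
open Literature.Geometry.Kaehler
open Literature.Topology.FourManifolds
open Literature.NumberTheory.Automorphic.AutomorphyFactor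

namespace Literature.AlgebraicGeometry.ShimuraVarieties

namespace BallFS

open BallForms (canonicalFactor canonicalCocycle canonicalFactor_ne_zero)
open BallDescent (chart mk_mem_chart_source chart_mk_self mk_chart contMDiffAt_chart
  mdifferentiableAt_chart transAt transAt_smul eventually_transAt_eq isHolCocycle_canonicalFactor_pow)

variable {Δ : Subgroup U21} [ProperlyDiscontinuousSMul Δ Ball] [IsCancelSMul Δ Ball] {N k : ℕ}

/-! ### The Fubini–Study potential `α₀` and its pull-backs -/

section Potential

variable {W : Type*} [NormedAddCommGroup W] [InnerProductSpace ℂ W]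
  {EN : Type*} [NormedAddCommGroup EN] [NormedSpace ℝ EN]
  {HN : Type*} [TopologicalSpace HN] {IN : ModelWithCorners ℝ EN HN}
  {M : Type*} [TopologicalSpace M] [ChartedSpace HN M]

/-- The Fubini–Study potential `α₀(Z) = Im ⟪Z, ·⟫ / ‖Z‖²` as a `1`-form on the manifold `W`
(`β₀ = dα₀`). [cite: VoisinHodgeI2002, §3.3.2 Lemma 3.16] -/
def fsPotentialMForm : MForm 𝓘(ℝ, W) W ℝ 1 := fun Z ↦ (fubiniStudyPotential Z :)

/-- Unfolding of `fsPotentialMForm` (definitional). [cite: VoisinHodgeI2002, §3.3.2 Lemma 3.16] -/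
@[simp] theorem fsPotentialMForm_apply (Z : W) : fsPotentialMForm (W := W) Z = (fubiniStudyPotential Z :) :=
  rfl

/-- `dα₀ = β₀` on the manifold `W`. [cite: VoisinHodgeI2002, §3.3.2 Lemma 3.16] -/
theorem mextDeriv_fsPotentialMForm_apply (Z : W) :
    mextDeriv (fsPotentialMForm (W := W)) Z = fubiniStudyMForm (W := W) Z := by
  rw [mextDeriv_eq_extDeriv]
  rfl

/-- `α₀` is smooth off the origin. [cite: VoisinHodgeI2002, §3.3.2 Lemma 3.16] -/
theorem smoothAt_fsPotentialMForm {Z : W} (hZ : Z ≠ 0) : (fsPotentialMForm (W := W)).SmoothAt Z :=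
  (MForm.smoothAt_model_iff (fsPotentialMForm (W := W)) _).2 (contDiffAt_fubiniStudyPotential hZ)

/-- Evaluation of `G^*α₀`: `(G^*α₀)(x)(v) = Im ⟪G x, dG_x v⟫ / ‖G x‖²`. [cite: VoisinHodgeI2002, §3.3.2 Lemma 3.16] -/
theorem fsPotentialMForm_pullback_apply (G : M → W) (x : M) (v : Fin 1 → TangentSpace IN x) :
    (fsPotentialMForm (W := W)).pullback IN G x v =
      (‖G x‖ ^ 2)⁻¹ * (⟪G x, mvfderiv IN G x (v 0)⟫_ℂ).im := by
  simp only [MForm.pullback_apply, fsPotentialMForm_apply]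
  rfl

/-- The pull-back `G^*α₀` at `x` only depends on the germ of `G` at `x` (pull-back of forms, Warner 2.22).
[cite: WarnerGTM94, 2.22] -/
theorem fsPotentialMForm_pullback_congr_of_eventuallyEq {G G' : M → W} {x : M} (h : G =ᶠ[𝓝 x] G') :
    (fsPotentialMForm (W := W)).pullback IN G x = (fsPotentialMForm (W := W)).pullback IN G' x := by
  ext v
  rw [fsPotentialMForm_pullback_apply, fsPotentialMForm_pullback_apply, h.self_of_nhds,
    mvfderiv_congr_of_eventuallyEq' h]

/-- **Projective variance of `α₀`**: `α₀(cZ)(ca + νZ) = α₀(Z)(a) + Im(c̄ν)/|c|²` — unlike `β₀`, the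
potential picks up a term depending on `c, ν` only (the term `Im (df/f)` of `(fG)^*α₀ = G^*α₀ + Im(df/f)`).
[cite: GriffithsHarrisPrinciples1978, Ch. 0 §2] -/
theorem fubiniStudyPotential_smul_add_smul {Z : W} (hZ : Z ≠ 0) {c : ℂ} (hc : c ≠ 0) (ν : ℂ) (a : W) :
    (‖c • Z‖ ^ 2)⁻¹ * (⟪c • Z, c • a + ν • Z⟫_ℂ).im =
      (‖Z‖ ^ 2)⁻¹ * (⟪Z, a⟫_ℂ).im + (‖c‖ ^ 2)⁻¹ * (conj c * ν).im := by
  have hZ' : (‖Z‖ : ℝ) ≠ 0 := norm_ne_zero_iff.2 hZ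
  have hc' : (‖c‖ : ℝ) ≠ 0 := norm_ne_zero_iff.2 hc
  have hs : ⟪Z, Z⟫_ℂ = ((‖Z‖ ^ 2 : ℝ) : ℂ) :=
    Complex.ext (by rw [(inner_self_re_im Z).1, Complex.ofReal_re])
      (by rw [(inner_self_re_im Z).2, Complex.ofReal_im])
  have key : (⟪c • Z, c • a + ν • Z⟫_ℂ).im = ‖c‖ ^ 2 * (⟪Z, a⟫_ℂ).im + ‖Z‖ ^ 2 * (conj c * ν).im := by
    rw [inner_add_right, inner_smul_left, inner_smul_right, inner_smul_left, inner_smul_right, hs,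
      ← mul_assoc, Complex.conj_mul', ← Complex.ofReal_pow,
      show conj c * (ν * ((‖Z‖ ^ 2 : ℝ) : ℂ)) = ((‖Z‖ ^ 2 : ℝ) : ℂ) * (conj c * ν) by ring,
      Complex.add_im, Complex.im_ofReal_mul, Complex.im_ofReal_mul]
  rw [key, norm_smul, mul_pow]
  field_simp

/-- **The correction term of `(fG)^*α₀` does not depend on `G`**: for `f : M → ℂ` and
`G₁, G₂ : M → W` differentiable at `x` and non-zero there,
`(fG₁)^*α₀ − (fG₂)^*α₀ = G₁^*α₀ − G₂^*α₀` at `x`. [cite: GriffithsHarrisPrinciples1978, Ch. 0 §2] -/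
theorem fsPotentialMForm_pullback_smul_sub {f : M → ℂ} {G₁ G₂ : M → W} {x : M}
    (hf : MDifferentiableAt IN 𝓘(ℝ, ℂ) f x) (hG₁ : MDifferentiableAt IN 𝓘(ℝ, W) G₁ x)
    (hG₂ : MDifferentiableAt IN 𝓘(ℝ, W) G₂ x) (hf0 : f x ≠ 0) (h₁ : G₁ x ≠ 0) (h₂ : G₂ x ≠ 0) :
    (fsPotentialMForm (W := W)).pullback IN (fun y ↦ f y • G₁ y) x -
        (fsPotentialMForm (W := W)).pullback IN (fun y ↦ f y • G₂ y) x =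
      (fsPotentialMForm (W := W)).pullback IN G₁ x - (fsPotentialMForm (W := W)).pullback IN G₂ x := by
  ext v
  simp only [ContinuousAlternatingMap.sub_apply, fsPotentialMForm_pullback_apply,
    mvfderiv_smul_complex_apply hf hG₁, mvfderiv_smul_complex_apply hf hG₂]
  rw [fubiniStudyPotential_smul_add_smul h₁ hf0, fubiniStudyPotential_smul_add_smul h₂ hf0]
  ring

end Potential

/-! ### Two systems of the same weight: `[G₁]^*ω_FS − [G₂]^*ω_FS` is exact -/

section TwoSystems

variable {G₁ G₂ : Ball → EuclideanSpace ℂ (Fin (N + 1))}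
  (hG₁h : MDifferentiable 𝓘(ℂ, Fin 2 → ℂ) 𝓘(ℂ, EuclideanSpace ℂ (Fin (N + 1))) G₁)
  (hG₁ : G₁ ∈ factorForms Δ (canonicalCocycle (EuclideanSpace ℂ (Fin (N + 1))) k)) (h₁ : ∀ z, G₁ z ≠ 0)
  (hG₂h : MDifferentiable 𝓘(ℂ, Fin 2 → ℂ) 𝓘(ℂ, EuclideanSpace ℂ (Fin (N + 1))) G₂)
  (hG₂ : G₂ ∈ factorForms Δ (canonicalCocycle (EuclideanSpace ℂ (Fin (N + 1))) k)) (h₂ : ∀ z, G₂ z ≠ 0)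

variable (Δ G₁ G₂) in
/-- **The primitive of `[G₁]^*ω_FS − [G₂]^*ω_FS`**: at `y`, the difference of the pulled-back potentials
`(G₁ ∘ s)^*α₀ − (G₂ ∘ s)^*α₀` through the local section `s = s_{out y}` (independent of the section
for systems of the same weight, `fsPotDiff_eq_of_mem_source`). [cite: GriffithsHarrisPrinciples1978, Ch. 0 §2] -/
def fsPotDiff : MForm 𝓘(ℝ, Fin 2 → ℂ) (orbitRel.Quotient Δ Ball) ℝ 1 := fun y ↦
  (fsPotentialMForm (W := EuclideanSpace ℂ (Fin (N + 1)))).pullback 𝓘(ℝ, Fin 2 → ℂ) (G₁ ∘ chart Δ (Quotient.out y)) y -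
    (fsPotentialMForm (W := EuclideanSpace ℂ (Fin (N + 1)))).pullback 𝓘(ℝ, Fin 2 → ℂ) (G₂ ∘ chart Δ (Quotient.out y)) y

/-- `y` lies in the source of the section at its chosen representative. [cite: Shafarevich1994, Ch. VIII §1.2 (8.8)] -/
theorem mem_chart_out_source (y : orbitRel.Quotient Δ Ball) : y ∈ (chart Δ (Quotient.out y)).source := by
  have h := mk_mem_chart_source (Δ := Δ) (Quotient.out y)
  rwa [show QuotientManifold.mk (G := Δ) (Quotient.out y) = y from Quotient.out_eq y] at h

include hG₁h hG₁ h₁ hG₂h hG₂ h₂ in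
/-- **Independence of the section**: for EVERY `p` with `y` in the source of `s_p`,
`fsPotDiff y = (G₁ ∘ s_p)^*α₀ − (G₂ ∘ s_p)^*α₀` at `y` (two sections differ by a locally constant
`δ ∈ Δ`, `G ∘ (δ • s) = j(δ, s)⁻ᵏ • (G ∘ s)` for both systems, and the correction term of `α₀` only
depends on the common factor). [cite: GriffithsHarrisPrinciples1978, Ch. 0 §2] -/
theorem fsPotDiff_eq_of_mem_source {p : Ball} {y : orbitRel.Quotient Δ Ball} (hy : y ∈ (chart Δ p).source) :
    fsPotDiff Δ G₁ G₂ y =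
      (fsPotentialMForm (W := EuclideanSpace ℂ (Fin (N + 1)))).pullback 𝓘(ℝ, Fin 2 → ℂ) (G₁ ∘ chart Δ p) y -
        (fsPotentialMForm (W := EuclideanSpace ℂ (Fin (N + 1)))).pullback 𝓘(ℝ, Fin 2 → ℂ) (G₂ ∘ chart Δ p) y := by
  have hq := mem_chart_out_source (Δ := Δ) y
  obtain ⟨δ, hδ⟩ := eventually_transAt_eq hy hq
  -- the common factor `f = j(δ, s_p ·)⁻ᵏ`
  set f : orbitRel.Quotient Δ Ball → ℂ := fun y' ↦ (canonicalFactor (δ : U21) (chart Δ p y') ^ k)⁻¹ with hf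
  have hev : ∀ G : Ball → EuclideanSpace ℂ (Fin (N + 1)), G ∈ factorForms Δ (canonicalCocycle (EuclideanSpace ℂ (Fin (N + 1))) k) →
      (G ∘ chart Δ (Quotient.out y)) =ᶠ[𝓝 y] fun y' ↦ f y' • (G ∘ chart Δ p) y' := by
    intro G hG
    filter_upwards [hδ] with y' hy'
    simp only [Function.comp_apply, hf]
    rw [hy'.2.2.2]
    exact apply_smul_of_mem hG δ _
  have hfd : MDifferentiableAt 𝓘(ℝ, Fin 2 → ℂ) 𝓘(ℝ, ℂ) f y :=
    (((isHolCocycle_canonicalFactor_pow k).mdifferentiable_inv (δ : U21) _).comp _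
      (mdifferentiableAt_chart hy)).real_of_complex
  have hf0 : f y ≠ 0 := inv_ne_zero (pow_ne_zero _ (canonicalFactor_ne_zero _ _))
  rw [fsPotDiff, fsPotentialMForm_pullback_congr_of_eventuallyEq (hev G₁ hG₁),
    fsPotentialMForm_pullback_congr_of_eventuallyEq (hev G₂ hG₂)]
  exact fsPotentialMForm_pullback_smul_sub hfd (mdifferentiableAt_real_comp_chart hG₁h hy)
    (mdifferentiableAt_real_comp_chart hG₂h hy) hf0 (h₁ _) (h₂ _)

include hG₁h hG₁ h₁ hG₂h hG₂ h₂ in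
/-- Near every point, `fsPotDiff` IS the difference of two pulled-back potentials through one fixed
section. [cite: GriffithsHarrisPrinciples1978, Ch. 0 §2] -/
theorem fsPotDiff_eventuallyEq (p : Ball) {y : orbitRel.Quotient Δ Ball} (hy : y ∈ (chart Δ p).source) :
    ∀ᶠ y' in 𝓝 y, fsPotDiff Δ G₁ G₂ y' =
      ((fsPotentialMForm (W := EuclideanSpace ℂ (Fin (N + 1)))).pullback 𝓘(ℝ, Fin 2 → ℂ) (G₁ ∘ chart Δ p) -
        (fsPotentialMForm (W := EuclideanSpace ℂ (Fin (N + 1)))).pullback 𝓘(ℝ, Fin 2 → ℂ) (G₂ ∘ chart Δ p)) y' := by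
  filter_upwards [(chart Δ p).open_source.mem_nhds hy] with y' hy'
  exact fsPotDiff_eq_of_mem_source hG₁h hG₁ h₁ hG₂h hG₂ h₂ hy'

include hG₁h in
/-- `(G₁ ∘ s_p)^*α₀` is smooth at the points of the source of `s_p` (pull-back of a smooth form along a smooth
map, Warner 2.22). [cite: WarnerGTM94, 2.22] -/
theorem smoothAt_pullback_potential {p : Ball} {y : orbitRel.Quotient Δ Ball}
    (hy : y ∈ (chart Δ p).source) (h₁ : ∀ z, G₁ z ≠ 0) :
    ((fsPotentialMForm (W := EuclideanSpace ℂ (Fin (N + 1)))).pullback 𝓘(ℝ, Fin 2 → ℂ) (G₁ ∘ chart Δ p)).SmoothAt y := by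
  refine MForm.SmoothAt.pullback ?_ (smoothAt_fsPotentialMForm (h₁ _))
  filter_upwards [(chart Δ p).open_source.mem_nhds hy] with y' hy'
  exact contMDiffAt_real_comp_chart hG₁h hy'

include hG₁h hG₁ h₁ hG₂h hG₂ h₂ in
/-- `fsPotDiff` is a smooth `1`-form. [cite: GriffithsHarrisPrinciples1978, Ch. 0 §2] -/
theorem isSmoothForm_fsPotDiff : IsSmoothForm (fsPotDiff Δ G₁ G₂) := by
  intro y
  have hy := mem_chart_out_source (Δ := Δ) y
  exact ((smoothAt_pullback_potential hG₁h hy h₁).sub (smoothAt_pullback_potential hG₂h hy h₂)).congr_of_eventuallyEq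
    ((fsPotDiff_eventuallyEq hG₁h hG₁ h₁ hG₂h hG₂ h₂ _ hy).mono fun _ h ↦ h.symm)

include hG₁h in
/-- `d((G ∘ s_p)^*α₀) = (G ∘ s_p)^*β₀` at the points of the source of `s_p`. [cite: VoisinHodgeI2002, §3.1.3] -/
theorem mextDeriv_pullback_potential {p : Ball} {y : orbitRel.Quotient Δ Ball}
    (hy : y ∈ (chart Δ p).source) (h₁ : ∀ z, G₁ z ≠ 0) :
    mextDeriv ((fsPotentialMForm (W := EuclideanSpace ℂ (Fin (N + 1)))).pullback 𝓘(ℝ, Fin 2 → ℂ) (G₁ ∘ chart Δ p)) y =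
      fsPullback (Fin 2 → ℂ) (G₁ ∘ chart Δ p) y := by
  have hf : ∀ᶠ y' in 𝓝 y, ContMDiffAt 𝓘(ℝ, Fin 2 → ℂ) 𝓘(ℝ, EuclideanSpace ℂ (Fin (N + 1))) ∞ (G₁ ∘ chart Δ p) y' := by
    filter_upwards [(chart Δ p).open_source.mem_nhds hy] with y' hy'
    exact contMDiffAt_real_comp_chart hG₁h hy'
  rw [mextDeriv_pullback_apply hf (smoothAt_fsPotentialMForm (h₁ _))]
  ext v
  simp only [MForm.pullback_apply, mextDeriv_fsPotentialMForm_apply, fsPullback]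

include hG₁h hG₁ h₁ hG₂h hG₂ h₂ in
/-- **`[G₁]^*ω_FS − [G₂]^*ω_FS = d(fsPotDiff)`** for two projective systems of the same weight.
[cite: GriffithsHarrisPrinciples1978, Ch. 0 §2] -/
theorem fsForm_sub_fsForm_eq_mextDeriv :
    fsForm G₁ hG₁ h₁ - fsForm G₂ hG₂ h₂ = mextDeriv (fsPotDiff Δ G₁ G₂) := by
  funext y
  have hy := mem_chart_out_source (Δ := Δ) y
  set p := Quotient.out y
  set pb₁ := (fsPotentialMForm (W := EuclideanSpace ℂ (Fin (N + 1)))).pullback 𝓘(ℝ, Fin 2 → ℂ) (G₁ ∘ chart Δ p) with hpb₁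
  set pb₂ := (fsPotentialMForm (W := EuclideanSpace ℂ (Fin (N + 1)))).pullback 𝓘(ℝ, Fin 2 → ℂ) (G₂ ∘ chart Δ p) with hpb₂
  have hs₁ : pb₁.SmoothAt y := smoothAt_pullback_potential hG₁h hy h₁
  have hs₂ : pb₂.SmoothAt y := smoothAt_pullback_potential hG₂h hy h₂
  have hneg : mextDeriv (-pb₂) = -mextDeriv pb₂ := by
    rw [show -pb₂ = (-1 : ℝ) • pb₂ by simp, mextDeriv_smul]
    simp
  rw [mextDeriv_congr_of_eventuallyEq (fsPotDiff_eventuallyEq hG₁h hG₁ h₁ hG₂h hG₂ h₂ p hy),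
    sub_eq_add_neg pb₁, mextDeriv_add_apply hs₁ hs₂.neg, hneg, Pi.neg_apply, hpb₁, hpb₂,
    mextDeriv_pullback_potential hG₁h hy h₁, mextDeriv_pullback_potential hG₂h hy h₂, Pi.sub_apply,
    fsForm_eq_fsPullback_chart hG₁h hG₁ h₁ hy, fsForm_eq_fsPullback_chart hG₂h hG₂ h₂ hy, sub_eq_add_neg]

include hG₁h hG₁ h₁ hG₂h hG₂ h₂ in
/-- **Two projective systems of the same weight have cohomologous Fubini–Study forms**:
`[[G₁]^*ω_FS] = [[G₂]^*ω_FS]` in `H²_dR(Δ\𝔹²; ℝ)`. [cite: GriffithsHarrisPrinciples1978, Ch. 1 §2] -/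
theorem deRhamCohomology_mk_fsForm_eq :
    deRhamCohomology.mk ⟨fsForm G₁ hG₁ h₁, fsForm_mem_closedSmoothForms hG₁h hG₁ h₁⟩ =
      deRhamCohomology.mk ⟨fsForm G₂ hG₂ h₂, fsForm_mem_closedSmoothForms hG₂h hG₂ h₂⟩ := by
  rw [deRhamCohomology.mk_eq_mk_iff]
  show fsForm G₁ hG₁ h₁ - fsForm G₂ hG₂ h₂ ∈ exactSmoothForms 𝓘(ℝ, Fin 2 → ℂ) (orbitRel.Quotient Δ Ball) ℝ (1 + 1)
  rw [fsForm_sub_fsForm_eq_mextDeriv hG₁h hG₁ h₁ hG₂h hG₂ h₂]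
  exact Submodule.subset_span ⟨fsPotDiff Δ G₁ G₂,
    (mem_smoothForms_iff _).2 (isSmoothForm_fsPotDiff hG₁h hG₁ h₁ hG₂h hG₂ h₂), rfl⟩

end TwoSystems

end BallFS

/-! ### Twisted systems: the lift of `[G]` along a morphism over a translation of the ball -/

namespace BallFS

open BallForms (canonicalFactor canonicalCocycle canonicalFactor_ne_zero)
open BallDescent (isHolCocycle_canonicalFactor_pow)

variable {N k : ℕ}

/-- **The twist of a system along a translation of the ball**: `S_g G (z) = j(g, z)ᵏ • G(g z)`; if `G` is
automorphic of weight `k` for `Δ₂` and `g Δ₁ g⁻¹ ≤ Δ₂`, then `S_g G` is automorphic of weight `k` for `Δ₁`, and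
`[S_g G z] = [G (g z)]`. [cite: Shimura1971, §3.1 Prop. 3.1] -/
def twist (g : U21) (G : Ball → EuclideanSpace ℂ (Fin (N + 1))) (k : ℕ) : Ball → EuclideanSpace ℂ (Fin (N + 1)) := fun z ↦ canonicalFactor g z ^ k • G (g • z)

/-- Unfolding of `twist`. [cite: Shimura1971, §3.1 Prop. 3.1] -/
@[simp] theorem twist_apply (g : U21) (G : Ball → EuclideanSpace ℂ (Fin (N + 1))) (k : ℕ) (z : Ball) :
    twist g G k z = canonicalFactor g z ^ k • G (g • z) := rfl

/-- The twist of a nowhere-zero system is nowhere zero (`j ≠ 0`). [cite: Shafarevich1994, Ch. IX §3.1 (9.20)] -/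
theorem twist_ne_zero (g : U21) {G : Ball → EuclideanSpace ℂ (Fin (N + 1))} (h0 : ∀ z, G z ≠ 0) (z : Ball) : twist g G k z ≠ 0 :=
  smul_ne_zero (pow_ne_zero _ (canonicalFactor_ne_zero _ _)) (h0 _)

/-- The class `[S_g G z] = [G(g z)] ∈ ℂℙᴺ` of the twisted system. [cite: Shafarevich1994, Ch. IX §3.2] -/
theorem toCP_twist (g : U21) {G : Ball → EuclideanSpace ℂ (Fin (N + 1))} (h0 : ∀ z, G z ≠ 0) (z : Ball) :
    toCP (twist g G k z) = toCP (G (g • z)) :=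
  toCP_smul (pow_ne_zero _ (canonicalFactor_ne_zero _ _)) (h0 _)

/-- The twist of a holomorphic system is holomorphic. [cite: Shafarevich1994, Ch. IX §3.1] -/
theorem mdifferentiable_twist (g : U21) {G : Ball → EuclideanSpace ℂ (Fin (N + 1))} (hGh : MDifferentiable 𝓘(ℂ, Fin 2 → ℂ) 𝓘(ℂ, EuclideanSpace ℂ (Fin (N + 1))) G) :
    MDifferentiable 𝓘(ℂ, Fin 2 → ℂ) 𝓘(ℂ, EuclideanSpace ℂ (Fin (N + 1))) (twist g G k) := fun z ↦
  (((isHolCocycle_canonicalFactor_pow k).mdifferentiable g) z).smul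
    ((hGh _).comp z (((BallModel.contMDiff_smul g (n := ω)).mdifferentiable (by simp)) z))

/-- **Automorphy of the twist**: for `g Δ₁ g⁻¹ ≤ Δ₂` and `G` of weight `k` for `Δ₂`, `S_g G` is of weight `k`
for `Δ₁` (cocycle identity `j(gδ₁, z) = j(δ₁, z) j(g, δ₁ z) = j(g, z) j(gδ₁g⁻¹, g z)`). [cite: Shimura1971, §3.1 Prop. 3.1] -/
theorem twist_mem_factorForms {Δ₁ Δ₂ : Subgroup U21} {g : U21} (hconj : ∀ δ ∈ Δ₁, g * δ * g⁻¹ ∈ Δ₂)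
    {G : Ball → EuclideanSpace ℂ (Fin (N + 1))} (hG : G ∈ factorForms Δ₂ (canonicalCocycle (EuclideanSpace ℂ (Fin (N + 1))) k)) :
    twist g G k ∈ factorForms Δ₁ (canonicalCocycle (EuclideanSpace ℂ (Fin (N + 1))) k) := by
  intro δ hδ z
  rw [BallForms.canonicalCocycle_apply, twist_apply, twist_apply]
  have hδ₂ := hconj δ hδ
  have hGz := (mem_factorForms_iff.1 hG) _ hδ₂ (g • z)
  rw [BallForms.canonicalCocycle_apply] at hGz
  have hact : (g * δ * g⁻¹) • g • z = g • δ • z := by rw [← mul_smul, inv_mul_cancel_right, mul_smul]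
  rw [hact] at hGz
  -- the cocycle identity
  have hcoc : canonicalFactor g z * canonicalFactor (g * δ * g⁻¹) (g • z) =
      canonicalFactor δ z * canonicalFactor g (δ • z) := by
    rw [← BallForms.canonicalFactor_mul, ← BallForms.canonicalFactor_mul, inv_mul_cancel_right]
  rw [hGz]
  simp only [smul_smul, ← mul_pow]
  rw [hcoc]

variable {Δ₁ Δ₂ : Subgroup U21} [ProperlyDiscontinuousSMul Δ₁ Ball] [IsCancelSMul Δ₁ Ball]
  [ProperlyDiscontinuousSMul Δ₂ Ball] [IsCancelSMul Δ₂ Ball]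
  {G : Ball → EuclideanSpace ℂ (Fin (N + 1))} (hGh : MDifferentiable 𝓘(ℂ, Fin 2 → ℂ) 𝓘(ℂ, EuclideanSpace ℂ (Fin (N + 1))) G)
  (hG : G ∈ factorForms Δ₂ (canonicalCocycle (EuclideanSpace ℂ (Fin (N + 1))) k)) (h0 : ∀ z, G z ≠ 0)
  {g : U21} (hconj : ∀ δ ∈ Δ₁, g * δ * g⁻¹ ∈ Δ₂)
  {φ : orbitRel.Quotient Δ₁ Ball → orbitRel.Quotient Δ₂ Ball}
  (hφ : ∀ z : Ball, φ (QuotientManifold.mk (G := Δ₁) z) = QuotientManifold.mk (G := Δ₂) (g • z))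

omit [ProperlyDiscontinuousSMul Δ₁ Ball] [IsCancelSMul Δ₁ Ball] [ProperlyDiscontinuousSMul Δ₂ Ball]
  [IsCancelSMul Δ₂ Ball] in
include hφ in
/-- **A map of ball quotients lifting to the translation `z ↦ g z` pulls `[G]` back to `[S_g G]`.**
[cite: Shimura1971, §7.2–7.3] -/
theorem projMap_comp_eq_projMap_twist :
    projMap G hG h0 ∘ φ = projMap (twist g G k) (twist_mem_factorForms hconj hG) (twist_ne_zero g h0) := by
  funext y
  obtain ⟨z, rfl⟩ := Quotient.exists_rep y
  change projMap G hG h0 (φ (QuotientManifold.mk (G := Δ₁) z)) = _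
  rw [hφ, projMap_mk]
  exact (toCP_twist g h0 z).symm

include hGh hφ in
/-- **Pull-back of the Fubini–Study form along such a map**: `φ^*([G]^*ω_FS) = [S_g G]^*ω_FS`.
[cite: GriffithsHarrisPrinciples1978, Ch. 0 §2] -/
theorem fsForm_pullback_eq_fsForm_twist (hφd : MDifferentiable 𝓘(ℝ, Fin 2 → ℂ) 𝓘(ℝ, Fin 2 → ℂ) φ) :
    (fsForm G hG h0).pullback 𝓘(ℝ, Fin 2 → ℂ) φ =
      fsForm (twist g G k) (twist_mem_factorForms hconj hG) (twist_ne_zero g h0) := by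
  rw [fsForm, fsForm, ← MForm.pullback_comp (mdifferentiable_projMap hGh hG h0) hφd,
    projMap_comp_eq_projMap_twist hG h0 hconj hφ]

include hGh hφ in
/-- … hence, on de Rham classes, `φ^*[[G]^*ω_FS] = [[S_g G]^*ω_FS]`. [cite: GriffithsHarrisPrinciples1978, Ch. 0 §2] -/
theorem deRhamCohomology_map_mk_fsForm (hφs : ContMDiff 𝓘(ℝ, Fin 2 → ℂ) 𝓘(ℝ, Fin 2 → ℂ) ∞ φ) :
    deRhamCohomology.map hφs 2 (deRhamCohomology.mk ⟨fsForm G hG h0, fsForm_mem_closedSmoothForms hGh hG h0⟩) =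
      deRhamCohomology.mk ⟨fsForm (twist g G k) (twist_mem_factorForms hconj hG) (twist_ne_zero g h0),
        fsForm_mem_closedSmoothForms (mdifferentiable_twist g hGh) _ _⟩ := by
  rw [deRhamCohomology.map_mk]
  congr 1
  exact Subtype.ext (fsForm_pullback_eq_fsForm_twist hGh hG h0 hconj hφ (hφs.mdifferentiable (by simp)))

end BallFS

end Literature.AlgebraicGeometry.ShimuraVarieties

end
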